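import Summits.ValiantsHypothesis.ValiantsHypothesis.Theorems.ValuativeGCTValuativeFlipIntegralCut

/-!
# The valuative truncation contains the integral closure of `ℂ[Δ(det_m)]` (graded extraction)

Crux `ValuativeGCT.ValuativeFlip` (stmt-ValiantsHypothesis-12624), wall-breaker axis
"det-orbit-closure multiplicity bounds for the det census", part 3: from an ARBITRARY equation of
integral dependence to the homogeneous one used in `…ValuativeFlipIntegralCut.lean`.

* `icut_isHomogeneous_coeff_linSubst_generic` — bihomogeneity of the generic substitution: the
  `x^d`-coefficient of `f(Y·x)` is a form of degree `|d|` in the entries of the generic matrix `Y`;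
  hence `Φ = genericOrbitMap f m` maps forms of degree `n` to forms of degree `m n`
  (`icut_genericOrbitMap_isHomogeneous`) and commutes with homogeneous components up to the scaling
  `k ↦ m k` (`icut_homogeneousComponent_genericOrbitMap`);
* `icut_exists_homogeneous_equation` — a homogeneous `h` of degree `m δ` integral over the
  subalgebra `Φ(ℂ[Sym^m]) ⊆ ℂ[End W]` satisfies a HOMOGENEOUS equation
  `h ^ N + Σ_{i<N} Φ(F_i) h ^ i = 0`, `F_i` forms of degree `(N-i) δ` (degree-`m δ N` component);
* `icut_mem_pow_vanishingIdeal_of_isIntegral`, `icut_mem_truncation_of_isIntegral`,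
  `icut_finrank_le_finrank_truncation_of_isIntegral`, registered form `valuativeClause_of_isIntegral`
  — so the valuative clause `h ∈ I(L_U)^(δ(m-r))` of the crux holds on the whole weight-graded
  integral closure of `Φ(ℂ[Sym^m]) ≅ ℂ[Δ(det_m)]` in `ℂ[End W]`, for every centre `U` of rank `≤ r`:
  `T_U(χ)` contains the weight-`χ` part of the coordinate ring of the NORMALISATION of `Δ(det_m)`
  (Hüttenhain arXiv:1512.04352 Thm 4 places it inside `ℂ[End W]^Stab`), and the det census
  `dim T_U(λ)` is bounded below by the normalisation's count, uniformly in `U`.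

Elementary (graded rings); no definitions. [folklore]
-/

set_option linter.dupNamespace false

namespace Summit.ValiantsHypothesis.ValiantsHypothesis.Theorems.ValuativeFlip

open MvPolynomial
open scoped BigOperators Matrix
open Literature.NumberTheory.DiophantineGeometry Literature.Computability.AlgebraicComplexity
open Summit.ValiantsHypothesis.Theorems.ValuativeBoundNegative

noncomputable section

/-! ## §4 From an arbitrary equation of integral dependence: graded extraction -/

section Graded

variable {σ k : Type*} [Fintype σ] [DecidableEq σ] [CommRing k]

/-- **Bihomogeneity of the generic substitution.** For every polynomial `f`, the `x^d`-coefficient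
of `f(Y·x)` (`Y` the generic matrix) is a form of degree `|d|` in the entries of `Y`: each unit
of `x`-degree comes with exactly one entry of `Y`. [folklore] -/
theorem icut_isHomogeneous_coeff_linSubst_generic (f : MvPolynomial σ k) (d : σ →₀ ℕ) :
    (coeff d (linSubst σ (MvPolynomial (σ × σ) k) (Matrix.mvPolynomialX σ σ k)
      (map (C : k →+* MvPolynomial (σ × σ) k) f))).IsHomogeneous d.degree := by
  classical
  -- the predicate: every `x`-coefficient is a `Y`-form of the degree of its exponent
  set P : MvPolynomial σ (MvPolynomial (σ × σ) k) → Prop :=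
    fun g => ∀ d : σ →₀ ℕ, (coeff d g).IsHomogeneous d.degree with hP
  have hadd : ∀ g h, P g → P h → P (g + h) := fun g h hg hh d => by
    rw [coeff_add]; exact (hg d).add (hh d)
  have hmul : ∀ g h, P g → P h → P (g * h) := fun g h hg hh d => by
    rw [coeff_mul]
    refine IsHomogeneous.sum _ _ _ fun x hx => ?_
    have hdeg : d.degree = x.1.degree + x.2.degree := by
      rw [← map_add, Finset.HasAntidiagonal.mem_antidiagonal.mp hx]
    rw [hdeg]
    exact (hg x.1).mul (hh x.2)
  have hC : ∀ c : k, P (C (C c : MvPolynomial (σ × σ) k)) := fun c d => by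
    rw [coeff_C]
    split_ifs with h
    · subst h; rw [map_zero]; exact isHomogeneous_C _ _
    · exact isHomogeneous_zero _ _ _
  have hL : ∀ i : σ, P (∑ j : σ, Matrix.mvPolynomialX σ σ k j i • (X j : MvPolynomial σ (MvPolynomial (σ × σ) k))) := by
    intro i d
    rw [coeff_sum]
    refine IsHomogeneous.sum _ _ _ fun j _ => ?_
    rw [coeff_smul, coeff_X, smul_eq_mul]
    split_ifs with h
    · subst h
      rw [mul_one, Finsupp.degree_single]
      simpa [Matrix.mvPolynomialX] using isHomogeneous_X k (j, i)
    · rw [mul_zero]; exact isHomogeneous_zero _ _ _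
  suffices h : P (linSubst σ (MvPolynomial (σ × σ) k) (Matrix.mvPolynomialX σ σ k)
      (map (C : k →+* MvPolynomial (σ × σ) k) f)) from h d
  induction f using MvPolynomial.induction_on with
  | C c => rw [map_C, linSubst_C]; exact hC c
  | add p q hp hq => rw [map_add, map_add]; exact hadd _ _ hp hq
  | mul_X p i hp => rw [map_mul, map_X, map_mul, linSubst_X]; exact hmul _ _ hp (hL i)

omit [Fintype σ] [DecidableEq σ] in
/-- The degree-`n` component of `s · u` for a FORM `u` of degree `a ≤ n` is `s_{n-a} · u`
(as `Literature.RingTheory.MvPolynomial.homogeneousComponent_mul_of_isHomogeneous`, reproved here to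
keep the imports light). [folklore] -/
theorem icut_homogeneousComponent_mul_of_isHomogeneous {s u : MvPolynomial σ k} {a n : ℕ}
    (hu : u.IsHomogeneous a) (han : a ≤ n) :
    homogeneousComponent n (s * u) = homogeneousComponent (n - a) s * u := by
  classical
  have hs : s * u = ∑ i ∈ Finset.range (s.totalDegree + 1), homogeneousComponent i s * u := by
    rw [← Finset.sum_mul, sum_homogeneousComponent]
  rw [hs, map_sum, Finset.sum_eq_single (n - a)]
  · rw [homogeneousComponent_of_mem ((homogeneousComponent_isHomogeneous (n - a) s).mul hu),
      if_pos (Nat.sub_add_cancel han).symm]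
  · intro i _ hi
    rw [homogeneousComponent_of_mem ((homogeneousComponent_isHomogeneous i s).mul hu), if_neg]
    intro h
    exact hi (by omega)
  · intro hna
    rw [homogeneousComponent_eq_zero (n - a) s (by rw [Finset.mem_range] at hna; omega), zero_mul,
      map_zero]

end Graded

section GradedOrbit

variable {σ k : Type*} [Fintype σ] [LinearOrder σ] [Field k]

/-- **The generic orbit map scales degrees by `m`**: a form of degree `n` in the degree-`m`
coefficients becomes a form of degree `m n` in the matrix entries. [folklore] -/
theorem icut_genericOrbitMap_isHomogeneous (f : MvPolynomial σ k) (m : ℕ)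
    {F : MvPolynomial (DegIdx σ m) k} {n : ℕ} (hF : F.IsHomogeneous n) :
    (genericOrbitMap f m F).IsHomogeneous (m * n) := by
  have hg : ∀ d : DegIdx σ m, (coeff d.1 (linSubst σ (MvPolynomial (σ × σ) k)
      (Matrix.mvPolynomialX σ σ k) (map (C : k →+* MvPolynomial (σ × σ) k) f))).IsHomogeneous m := by
    intro d
    have h := icut_isHomogeneous_coeff_linSubst_generic f d.1
    rwa [mem_degMonomials_iff.mp d.2] at h
  have h := hF.aeval (fun d : DegIdx σ m => coeff d.1 (linSubst σ (MvPolynomial (σ × σ) k)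
      (Matrix.mvPolynomialX σ σ k) (map (C : k →+* MvPolynomial (σ × σ) k) f))) hg
  unfold genericOrbitMap
  exact h

/-- Homogeneous components commute with the generic orbit map up to the scaling `k ↦ m k`
(`m ≠ 0`). [folklore] -/
theorem icut_homogeneousComponent_genericOrbitMap (f : MvPolynomial σ k) {m : ℕ} (hm : m ≠ 0)
    (G : MvPolynomial (DegIdx σ m) k) (j : ℕ) :
    homogeneousComponent (m * j) (genericOrbitMap f m G) =
      genericOrbitMap f m (homogeneousComponent j G) := by
  classical
  conv_lhs => rw [← sum_homogeneousComponent G, map_sum, map_sum]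
  have hterm : ∀ i, homogeneousComponent (m * j) (genericOrbitMap f m (homogeneousComponent i G)) =
      if i = j then genericOrbitMap f m (homogeneousComponent j G) else 0 := by
    intro i
    rw [homogeneousComponent_of_mem
      (icut_genericOrbitMap_isHomogeneous f m (homogeneousComponent_isHomogeneous i G))]
    by_cases hij : i = j
    · subst hij; simp
    · rw [if_neg (fun h => hij (Nat.eq_of_mul_eq_mul_left (Nat.pos_of_ne_zero hm) h).symm),
        if_neg hij]
  simp_rw [hterm]
  rw [Finset.sum_ite_eq']
  split_ifs with hj
  · rfl
  · rw [homogeneousComponent_eq_zero j G (by rw [Finset.mem_range] at hj; omega), map_zero]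

end GradedOrbit

section IsIntegral

variable {m : ℕ}

/-- **Graded extraction.** A homogeneous `h` of degree `m δ` (`m ≠ 0`) that is integral over
the pulled-back coordinate ring `Φ(ℂ[Sym^m])` (`Φ = genericOrbitMap f m`) satisfies a
HOMOGENEOUS equation of integral dependence `h ^ N + Σ_{i<N} Φ(F_i) h ^ i = 0` with forms `F_i`
of degree `(N-i) δ` (take the degree-`N m δ` component of any monic equation;
`icut_homogeneousComponent_genericOrbitMap`). [folklore] -/
theorem icut_exists_homogeneous_equation [NeZero m] (f : MvPolynomial (MatIdx m) ℂ) {δ : ℕ}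
    {h : MvPolynomial (MatIdx m × MatIdx m) ℂ} (hhom : h.IsHomogeneous (m * δ))
    (hint : IsIntegral (genericOrbitMap f m).range h) :
    ∃ (N : ℕ) (F : ℕ → MvPolynomial (DegIdx (MatIdx m) m) ℂ),
      (∀ i < N, (F i).IsHomogeneous ((N - i) * δ)) ∧
      h ^ N + ∑ i ∈ Finset.range N, genericOrbitMap f m (F i) * h ^ i = 0 := by
  classical
  obtain ⟨p, hp, hph⟩ := hint
  set N := p.natDegree with hN
  -- coefficients of `p` are values of `Φ`
  have hcoef : ∀ i, ∃ G : MvPolynomial (DegIdx (MatIdx m) m) ℂ, genericOrbitMap f m G = (p.coeff i : MvPolynomial (MatIdx m × MatIdx m) ℂ) :=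
    fun i => (AlgHom.mem_range _).mp (p.coeff i).2
  choose G hG using hcoef
  refine ⟨N, fun i => homogeneousComponent ((N - i) * δ) (G i), fun i _ => homogeneousComponent_isHomogeneous _ _, ?_⟩
  -- the inhomogeneous equation
  have heq : h ^ N + ∑ i ∈ Finset.range N, genericOrbitMap f m (G i) * h ^ i = 0 := by
    have h1 : Polynomial.eval₂ (algebraMap (genericOrbitMap f m).range (MvPolynomial (MatIdx m × MatIdx m) ℂ)) h p = 0 := hph
    rw [hp.as_sum, Polynomial.eval₂_add, Polynomial.eval₂_X_pow, Polynomial.eval₂_finsetSum] at h1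
    rw [← h1]
    congr 1
    refine Finset.sum_congr rfl fun i _ => ?_
    rw [Polynomial.eval₂_mul, Polynomial.eval₂_C, Polynomial.eval₂_X_pow, hG i]
    rfl
  -- its degree-`m δ N` component
  have hcomp := congr_arg (homogeneousComponent (m * δ * N)) heq
  rw [map_zero, map_add, map_sum, homogeneousComponent_eq_self (hhom.pow N)] at hcomp
  rw [← hcomp]
  congr 1
  refine Finset.sum_congr rfl fun i hi => ?_
  have hiN : i ≤ N := (Finset.mem_range.mp hi).le
  rw [icut_homogeneousComponent_mul_of_isHomogeneous (hhom.pow i) (Nat.mul_le_mul_left _ hiN)]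
  congr 1
  have hsub : m * δ * N - m * δ * i = m * ((N - i) * δ) := by
    rw [mul_comm (m * δ) N, mul_comm (m * δ) i, ← Nat.sub_mul]; ring
  rw [hsub, icut_homogeneousComponent_genericOrbitMap f (NeZero.ne m)]

/-- **The valuative clause is automatic on the integral closure of `Φ(ℂ[Sym^m]) ≅ ℂ[Δ(det_m)]`.**
A homogeneous `h ∈ ℂ[End W]` of degree `m δ` that is integral over the subalgebra
`Φ(ℂ[Sym^m])` lies in `I(L_U)^(δ(m-r))` for every centre `U` of rank `≤ r`. [folklore] -/
theorem icut_mem_pow_vanishingIdeal_of_isIntegral [NeZero m] (U : Submodule ℂ (MatIdx m → ℂ))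
    {r : ℕ} (hU : ∀ u ∈ U, (Matrix.of fun a b : Fin m => u (toLex (a, b))).rank ≤ r) {δ : ℕ}
    {h : MvPolynomial (MatIdx m × MatIdx m) ℂ} (hhom : h.IsHomogeneous (m * δ))
    (hint : IsIntegral (genericOrbitMap (detFormLex ℂ m) m).range h) :
    h ∈ MvPolynomial.vanishingIdeal ℂ (rowLocus m U) ^ (δ * (m - r)) := by
  obtain ⟨N, F, hF, heq⟩ := icut_exists_homogeneous_equation (detFormLex ℂ m) hhom hint
  exact icut_mem_pow_vanishingIdeal_of_homogeneous_integral U hU h N δ F hF heq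

/-- **`T_U(χ)` contains the weight-`χ` part of the integral closure of `ℂ[Δ(det_m)]` in
`ℂ[End W]`**: a homogeneous Stab-invariant `B_χ`-semi-invariant of degree `m δ` that is integral
over `Φ(ℂ[Sym^m])` lies in `truncation m L_U (δ(m-r)) (mδ) χ` for every centre `U` of rank `≤ r`.
With Hüttenhain's embedding `ℂ[Nor Δ(det_m)] ↪ ℂ[End W]^Stab` (arXiv:1512.04352 Thm 4) this is
the inequality `(multiplicity of λ* in ℂ[Nor Δ(det_m)]) ≤ dim T_U(λ)` of the route's census,
uniformly in `U`. [folklore] -/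
theorem icut_mem_truncation_of_isIntegral [NeZero m] (U : Submodule ℂ (MatIdx m → ℂ))
    {r : ℕ} (hU : ∀ u ∈ U, (Matrix.of fun a b : Fin m => u (toLex (a, b))).rank ≤ r) {δ : ℕ}
    (χ : Weight (MatIdx m)) {h : MvPolynomial (MatIdx m × MatIdx m) ℂ}
    (hhom : h ∈ MvPolynomial.homogeneousSubmodule (MatIdx m × MatIdx m) ℂ (m * δ))
    (hstab : h ∈ stabInvariants m) (hbor : h ∈ borelSemiInvariants m χ)
    (hint : IsIntegral (genericOrbitMap (detFormLex ℂ m) m).range h) :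
    h ∈ truncation m (rowLocus m U) (δ * (m - r)) (m * δ) χ :=
  mem_truncation_iff.mpr ⟨hhom, icut_mem_pow_vanishingIdeal_of_isIntegral U hU
    ((mem_homogeneousSubmodule _ _).mp hhom) hint, hstab, hbor⟩

/-- **Census form.** Every space of homogeneous Stab-invariant `B_χ`-semi-invariants of degree
`m δ` that are integral over `Φ(ℂ[Sym^m])` has dimension at most `dim T_U(χ)`, for every centre
`U` of rank `≤ r`. [folklore] -/
theorem icut_finrank_le_finrank_truncation_of_isIntegral [NeZero m] (U : Submodule ℂ (MatIdx m → ℂ))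
    {r : ℕ} (hU : ∀ u ∈ U, (Matrix.of fun a b : Fin m => u (toLex (a, b))).rank ≤ r)
    (δ : ℕ) (χ : Weight (MatIdx m)) (N' : Submodule ℂ (MvPolynomial (MatIdx m × MatIdx m) ℂ))
    (hN' : ∀ h ∈ N', h ∈ MvPolynomial.homogeneousSubmodule (MatIdx m × MatIdx m) ℂ (m * δ) ∧
      h ∈ stabInvariants m ∧ h ∈ borelSemiInvariants m χ ∧
      IsIntegral (genericOrbitMap (detFormLex ℂ m) m).range h) :
    Module.finrank ℂ N' ≤ Module.finrank ℂ (truncation m (rowLocus m U) (δ * (m - r)) (m * δ) χ) := by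
  haveI : Module.Finite ℂ (MvPolynomial.homogeneousSubmodule (MatIdx m × MatIdx m) ℂ (m * δ)) :=
    finite_homogeneousSubmodule _ _ _
  haveI : Module.Finite ℂ (truncation m (rowLocus m U) (δ * (m - r)) (m * δ) χ) :=
    Submodule.finiteDimensional_of_le fun _ hx => (mem_truncation_iff.mp hx).1
  refine Submodule.finrank_mono fun h hh => ?_
  obtain ⟨hhom, hstab, hbor, hint⟩ := hN' h hh
  exact icut_mem_truncation_of_isIntegral U hU χ hhom hstab hbor hint

end IsIntegral

/-! ## Registered form (sub-goal `valuativeClause_of_isIntegral`) -/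

/-- **The valuative clause on the integral closure of `ℂ[Δ(det_m)]`** — registered sub-goal form of
`icut_mem_pow_vanishingIdeal_of_isIntegral` in the crux's literal vocabulary: for `m ≥ 1`, every
centre `U` of rank `≤ r`, every homogeneous `h` of degree `m δ` integral over the subalgebra
`Φ(ℂ[Sym^m]) ⊆ ℂ[End W]` (`Φ = genericOrbitMap det_m m`), `h ∈ I(L_U)^(δ(m-r))`. [folklore] -/
theorem valuativeClause_of_isIntegral :
    ∀ (m : ℕ) [NeZero m] (U : Submodule ℂ (MatIdx m → ℂ)) (r : ℕ), (∀ u ∈ U, (Matrix.of fun a b : Fin m => u (toLex (a, b))).rank ≤ r) → ∀ (δ : ℕ) (h : MvPolynomial (MatIdx m × MatIdx m) ℂ), h.IsHomogeneous (m * δ) → IsIntegral (genericOrbitMap (detFormLex ℂ m) m).range h → h ∈ MvPolynomial.vanishingIdeal ℂ {p : MatIdx m × MatIdx m → ℂ | ∀ j : MatIdx m, (fun i => p (j, i)) ∈ U} ^ (δ * (m - r)) :=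
  fun _ _ U _ hU _ _ hhom hint => icut_mem_pow_vanishingIdeal_of_isIntegral U hU hhom hint

end

end Summit.ValiantsHypothesis.ValiantsHypothesis.Theorems.ValuativeFlip
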